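import Summits.QuantumFields.YangMills.Theorems.BalabanUVNodesK0AxJoinTBoxD9
import Summits.QuantumFields.YangMills.Theorems.BalabanUVNodesPortU8ImagesPackage

/-!
# NODE O · K0ᴬ — THE BOX ROAD WITHOUT (Tok-cmpU-cap): ★★★ `twoVolExpBox_LocUniv_images_geom` and the K0ᴬ door ★ `record13SepCoPHInhabitedAx_of_chartRowsBox_pvolAbsMomentBox_cofinalRadii_images`
# — ✓`…K0AxJoinTBoxD9` §10e∕§10f VERBATIM with the displayed hypothesis `TokCmpUCap F Mc a₀` DELETED (D9 := ★★★ PTB-1's token-free ✓`PortU8.portPieceLocalityU8_LocUniv_images`, method of images)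

Cell `ym-nodeO-ideate` ∕ `ym-balaban-port`, porter `ymgap-nodeO-port-PTB-1` (gen 5).  JOIN-side helper for **stmt-QuantumFields-27238** (K0ᴬ), `--supports … --as helper` (NO `--workitem`).
The two theorems below are ✓`K0AxMomentRoad.twoVolExpBox_LocUniv_of_cmp_geom` and ✓`K0AxMomentRoad.record13SepCoPHInhabitedAx_of_cmp_chartRowsBox_pvolAbsMomentBox_cofinalRadii` (▶ PTC-1 g4
INTENT-41 = ★ P3 №8; ◆ CRIT-1 custody PASS 6∕6, nodeO STATUS 2026-08-31T10:04:11Z) with EXACTLY ONE change each: the conjunct∕binder `TokCmpUCap F Mc a₀` is removed, and the D9 package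
`∃ C₉ δ₀, Response9DAtLocUnivξ …` is taken from ✓`PortU8.portPieceLocalityU8_LocUniv_images F Mc a₀ hMc α₂ hα₂` (g5 Images files 1–5: the two volumes' whole-torus localized responses
periodise ONE infinite-lattice kernel [B5] (1.63); NEAR difference = two lattice tails; ‴ = the proved clause files).  (Q-ord) unchanged (`∃ C₉ δ₀` revealed after all displayed rows, as in §10e).

WHAT REMAINS DISPLAYED in the door's `H`, EXACTLY: the numeric guards; (V-absmom-box) `RecordPvolAbsMomentOnBoxAx`; [∃ ONE chart family `ιC`: D1 = ⁸'s mould `FormatPlusG` AT EVERY BOX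
HISTORY (W1 ⟨27930⟩) ∧ the swap row ∧ the `C²`∕zero∕link rows against `recordGkLocWξ … univ` ((ra-1)(ra-3)(ra-4) + `DressLink` ⟸ (C-orb), OPEN)].  (Tok-cmpU-cap) is GONE.

HONEST FRAMING.  CONDITIONAL theorems over DISPLAYED row predicates; NO `sorry`; nothing of Bałaban ([I] Thm 1∕3, (1.7), (1.18)–(1.22), (4.35)–(4.37), (5.10); [15] Prop. 9; [II] (2.130))
asserted, ported, discharged or refuted beyond the kernel theorems cited; (E-lu-box) ∕ [E] inhabited unconditionally NOWHERE; K0ᴬ stmt-QuantumFields-27238 OPEN (this door's `H` is NOT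
inhabited); 27931 CLOSED·IMPLICATION-ONLY·IN TOTO unchanged; NODE O 0∕1; COUNT 8∕28 · K 1∕4 UNMOVED; finite `𝕋⁴_{L^K}` at fixed ε — NOT continuum ∕ ℝ⁴ ∕ OS ∕ Clay;
**the Yang–Mills mass gap is NOT proved by any of this.**  No `instance`, `notation`, `private`; standard axioms.
-/

noncomputable section

open Filter Topology
open scoped BigOperators Matrix.Norms.L2Operator

namespace Summit.QuantumFields.YangMills.Theorems.K0AxMomentRoad

open Literature.MathematicalPhysics.QuantumFieldTheory.Balaban1983to89
open Literature.MathematicalPhysics.QuantumFieldTheory.Balaban1983to89.Node00 (TermFamily1 siteOfInt polWindow polScalar betaOfRecord₁₃Ax Stage13Params)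
open Literature.MathematicalPhysics.QuantumFieldTheory.Balaban1983to89.T4Continuum (T4Family)
open Literature.MathematicalPhysics.QuantumFieldTheory.Balaban1983to89.B12FormatPlus
open Literature.MathematicalPhysics.QuantumFieldTheory.Balaban1983to89.B12Decay510 (SiteGeometry GeomLeaf CubeSumLeaf TreeLeaf KernelBound delta1 mixedDeriv)
open Summit.QuantumFields.YangMills.Theorems.K0RecordFormatNames
open Summit.QuantumFields.YangMills.Theorems.K0AxTwoVolumeRate (RecordPvolTwoVolExpOnRunsAx)
open Summit.QuantumFields.YangMills.Theorems.K0AxJoinT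
open Summit.QuantumFields.YangMills.Theorems.K0AxJoinTGeomA (rowG0)
open Summit.QuantumFields.YangMills.Theorems.K0AxJoinTGeomB (rowG1_at_recordChoice rowG2_at_recordChoice)
open Summit.QuantumFields.YangMills.Theorems.PortHRecordRowG (rowCubeSumLeaf_at rowTreeLeaves_at mc_pos)
open Literature.MathematicalPhysics.QuantumFieldTheory.Balaban1983to89.FlowStep
open Literature.MathematicalPhysics.QuantumFieldTheory.Balaban1983to89.FlowStepRuns

/-! ## §1  (E-lu-box) with D9 by the method of images — no (Tok-cmpU-cap) -/

/-- ★★★ **(E-lu-box) FROM ⁸'s MOULD ON THE BOX + THE CHART ROWS AGAINST THE TRANSVERSE TABLE — NO (Tok-cmpU-cap)**: ✓`twoVolExpBox_LocUniv_of_cmp_geom` with its first displayed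
input deleted; the D9 row (`∃ C₉ δ₀, Response9DAtLocUnivξ …` at `α₂ := min ¼ (min α₁ (α₀∕36))`) is ★★★ PTB-1's token-free ✓`PortU8.portPieceLocalityU8_LocUniv_images`.  What stays displayed:
D1 on the box, the swap row and the `C²`∕zero∕link rows of the ONE chart `ιC`, the guards.  CONDITIONAL; nothing of Bałaban asserted; K0ᴬ 27238 OPEN; the Yang–Mills mass gap is NOT proved.
[cite: Balaban1987RG1, Thm 1 p.259, Thm 3 p.264, (1.7) p.261, (1.18)–(1.22) pp.263–264, (4.4)–(4.5) pp.281–282, (4.35)–(4.37) pp.290–291, (5.10) p.293; Balaban1985Variational, Prop. 9 p.309, (190) p.308; Balaban1984PropagatorsI, (1.63) p.28, p.36 ll.20–23] -/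
theorem twoVolExpBox_LocUniv_images_geom {E₀ κ Mg c₁ : ℝ}
    (hE₀ : 0 ≤ E₀) (hκ : 0 < κ) (hκ₀ : 4 * B12TreeDecay.kappa₀ (4 * 2 ^ 4) (2 * 4) ≤ κ) (hc₁ : 0 ≤ c₁) :
    ∀ (F : T4Family) (a₀ ε₂₉ γ₀ α₀ α₁ : ℝ), 0 < ε₂₉ → 0 < α₀ → 0 < α₁ → ∀ Mc : ℕ, McGuard F Mc → (Mc : ℝ) ≤ Mg →
      letI θ := thetaFill F a₀ ε₂₉; letI := θ.instVβ₁; letI := θ.instVβ₂; letI := θ.instιβ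
      ∀ ιC : (k n : ℕ) → recordW F a₀ ε₂₉ k (recordK₀ F Mc k + n) → (Fin (recordChartDimJ F (recordK₀ F Mc k + n)) → ℂ),
      (∀ (k : ℕ) (v : Fin (k + 1) → ℝ), v ∈ FlowStep.Box γ₀ k →
        B12FormatPlus.FormatPlusG (fun n => recordDomSys F Mc k (recordK₀ F Mc k + n)) (fun n => recordBondCount F (recordK₀ F Mc k + n))
          (fun n => recordAct F (recordK₀ F Mc k + n)) (fun n => recordUc F Mc k α₀ α₁ (recordK₀ F Mc k + n))
          (fun n => recordCoords F Mc k (recordK₀ F Mc k + n)) (fun n => recordChartDimJ F (recordK₀ F Mc k + n))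
          (fun n => recordChartJ F Mc k (recordK₀ F Mc k + n)) (fun n => recordΦfAx F a₀ ε₂₉ k v (recordK₀ F Mc k + n))
          (fun n => recordEmbJ F θ k (recordK₀ F Mc k + n)) (fun n => recordWrapCtr F Mc k (recordK₀ F Mc k + n))
          (fun n => recordDomEmbCtr F Mc k (recordK₀ F Mc k + n)) (fun n _ => recordCoordProjCtr F (recordK₀ F Mc k + n)) E₀ κ) →
      (∀ (k n : ℕ), ∀ᶠ B in 𝓝 (0 : recordW F a₀ ε₂₉ k (recordK₀ F Mc k + n)), ∀ X : (recordDomSys F Mc k (recordK₀ F Mc k + n)).Dom,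
          ∃ g : recordGaugeGrp F (recordK₀ F Mc k + n), ∀ i ∈ recordCoords F Mc k (recordK₀ F Mc k + n) X,
            recordChartJ F Mc k (recordK₀ F Mc k + n) X (ιC k n B) i =
              recordAct F (recordK₀ F Mc k + n) g (recordChartJ F Mc k (recordK₀ F Mc k + n) X (recordEmbJ F θ k (recordK₀ F Mc k + n) B)) i) →
      (∀ k : ℕ, (∀ n : ℕ, ContDiffAt ℝ 2 (ιC k n) 0 ∧ ιC k n 0 = 0) ∧
          ∀ (n : ℕ) (a : θ.ιβ) (l : RespLabel F k (recordK₀ F Mc k + n)),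
            recordGkLocWξ F θ k (recordK₀ F Mc k + n) Finset.univ a l = fun i => fderiv ℝ (ιC k n) 0 (Pi.single l.1 (Pi.single l.2 (θ.bV a))) i) →
      ∃ C₉ δ₀ : ℝ, 0 ≤ C₉ ∧ 0 < δ₀ ∧
        RecordPvolTwoVolExpLocUnifOnBoxAx F a₀ ε₂₉ γ₀
          (48 * E₀ * C₉ ^ 2 * B12TreeDecay.K₀ (4 * 2 ^ 4) (2 * 4) * (2 * (1 - Real.exp (-(δ₀ / 4 * (Mc : ℝ))))⁻¹) ^ 4 +
            32 * E₀ * C₉ ^ 2 * Real.exp (B12Decay510.delta1 δ₀ κ Mg * Mg * c₁) * B12TreeDecay.K₀ (4 * 2 ^ 4) (2 * 4) *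
              (2 * (1 - Real.exp (-(δ₀ / 4 * (Mc : ℝ))))⁻¹) ^ 4)
          (B12Decay510.delta1 δ₀ κ Mg * (1 / 16)) := by
  intro F a₀ ε₂₉ γ₀ α₀ α₁ hε hα₀ hα₁ Mc hMc hMgMc ιC h8 hsw h9
  have hα₂ : 0 < min (1 / 4 : ℝ) (min α₁ (α₀ / 36)) := lt_min (by norm_num) (lt_min hα₁ (by positivity))
  obtain ⟨C₉, δ₀, hC₉, hδ₀, hpk⟩ := PortU8.portPieceLocalityU8_LocUniv_images F Mc a₀ hMc (min (1 / 4 : ℝ) (min α₁ (α₀ / 36))) hα₂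
  exact ⟨C₉, δ₀, hC₉, hδ₀, recordPvolTwoVolExpLocUnifOnBoxAx_of_rows_box_LocUniv_geom hE₀ hκ hκ₀ hC₉ hδ₀ hc₁ F a₀ ε₂₉ γ₀ α₀ α₁ hα₀ hα₁ Mc hMc hMgMc ιC h8 hsw
    fun k => ⟨fun a => (hpk k ε₂₉ hε).1 a, (h9 k).1, (h9 k).2⟩⟩

/-! ## §2  The cofinal-radii K0ᴬ door without (Tok-cmpU-cap) -/

/-- ★ **THE COFINAL-RADII K0ᴬ DOOR OVER THE ROAD OF RECORD'S DISPLAYED ROWS, (Tok-cmpU-cap) REMOVED**: ✓`record13SepCoPHInhabitedAx_of_cmp_chartRowsBox_pvolAbsMomentBox_cofinalRadii` with the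
conjunct `TokCmpUCap F Mc a₀` deleted from `H` — if for every continuum family and cofinally small radii there are the guards' letters with (V-absmom-box) and ONE chart family `ιC` carrying
⁸'s mould at every box history, the swap row and the `C²`∕zero∕link rows against `recordGkLocWξ … univ`, THEN K0ᴬ `Record13SepCoPHInhabitedAx` holds BY NAME (§1, then №7's ★★★ box door).
CONDITIONAL door: every remaining conjunct of `H` is OPEN content (D1 = W1 ⟨27930⟩; the chart rows = (ra-1)(ra-3)(ra-4) + `DressLink`; (V-absmom-box)); `H` is NOT inhabited here; K0ᴬ 27238 OPEN;
NODE O 0∕1; the Yang–Mills mass gap is NOT proved.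
[cite: Balaban1987RG1, Thm 1 p.259, Thm 3 p.264, (0.20) p.256, (1.7) p.261, (1.18)–(1.22) pp.263–264, (4.35)–(4.37) pp.290–291, (5.42) p.297; Balaban1985Variational, Prop. 9 p.309, (190) p.308; Balaban1984PropagatorsI, p.36 ll.20–23] -/
theorem record13SepCoPHInhabitedAx_of_chartRowsBox_pvolAbsMomentBox_cofinalRadii_images
    (H : ∀ F : T4Family, ∀ a : ℝ, 0 < a → ∃ a₀ : ℝ, 0 < a₀ ∧ a₀ ≤ a ∧ ∃ (γ₀ ε₂₉ M E₀ κ Mg c₁ α₀ α₁ : ℝ) (Mc : ℕ),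
      0 < γ₀ ∧ γ₀ ≤ 1 / 2 ∧ 0 < ε₂₉ ∧ 0 ≤ E₀ ∧ 0 < κ ∧ 4 * B12TreeDecay.kappa₀ (4 * 2 ^ 4) (2 * 4) ≤ κ ∧ 0 ≤ c₁ ∧ 0 < α₀ ∧ 0 < α₁ ∧ McGuard F Mc ∧ (Mc : ℝ) ≤ Mg ∧
      RecordPvolAbsMomentOnBoxAx F a₀ ε₂₉ γ₀ M ∧
      (letI θ := thetaFill F a₀ ε₂₉; letI := θ.instVβ₁; letI := θ.instVβ₂; letI := θ.instιβ;
        ∃ ιC : (k n : ℕ) → recordW F a₀ ε₂₉ k (recordK₀ F Mc k + n) → (Fin (recordChartDimJ F (recordK₀ F Mc k + n)) → ℂ),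
        (∀ (k : ℕ) (v : Fin (k + 1) → ℝ), v ∈ FlowStep.Box γ₀ k →
          B12FormatPlus.FormatPlusG (fun n => recordDomSys F Mc k (recordK₀ F Mc k + n)) (fun n => recordBondCount F (recordK₀ F Mc k + n))
            (fun n => recordAct F (recordK₀ F Mc k + n)) (fun n => recordUc F Mc k α₀ α₁ (recordK₀ F Mc k + n))
            (fun n => recordCoords F Mc k (recordK₀ F Mc k + n)) (fun n => recordChartDimJ F (recordK₀ F Mc k + n))
            (fun n => recordChartJ F Mc k (recordK₀ F Mc k + n)) (fun n => recordΦfAx F a₀ ε₂₉ k v (recordK₀ F Mc k + n))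
            (fun n => recordEmbJ F θ k (recordK₀ F Mc k + n)) (fun n => recordWrapCtr F Mc k (recordK₀ F Mc k + n))
            (fun n => recordDomEmbCtr F Mc k (recordK₀ F Mc k + n)) (fun n _ => recordCoordProjCtr F (recordK₀ F Mc k + n)) E₀ κ) ∧
        (∀ (k n : ℕ), ∀ᶠ B in 𝓝 (0 : recordW F a₀ ε₂₉ k (recordK₀ F Mc k + n)), ∀ X : (recordDomSys F Mc k (recordK₀ F Mc k + n)).Dom,
            ∃ g : recordGaugeGrp F (recordK₀ F Mc k + n), ∀ i ∈ recordCoords F Mc k (recordK₀ F Mc k + n) X,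
              recordChartJ F Mc k (recordK₀ F Mc k + n) X (ιC k n B) i =
                recordAct F (recordK₀ F Mc k + n) g (recordChartJ F Mc k (recordK₀ F Mc k + n) X (recordEmbJ F θ k (recordK₀ F Mc k + n) B)) i) ∧
        (∀ k : ℕ, (∀ n : ℕ, ContDiffAt ℝ 2 (ιC k n) 0 ∧ ιC k n 0 = 0) ∧
            ∀ (n : ℕ) (a : θ.ιβ) (l : RespLabel F k (recordK₀ F Mc k + n)),
              recordGkLocWξ F θ k (recordK₀ F Mc k + n) Finset.univ a l = fun i => fderiv ℝ (ιC k n) 0 (Pi.single l.1 (Pi.single l.2 (θ.bV a))) i))) :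
    Summit.QuantumFields.YangMills.Theses.BalabanUVNodes.Record13SepCoPHInhabitedAx := by
  refine record13SepCoPHInhabitedAx_of_twoVolExpBox_pvolAbsMomentBox_cofinalRadii fun F a ha => ?_
  obtain ⟨a₀, ha₀, hle, γ₀, ε₂₉, M, E₀, κ, Mg, c₁, α₀, α₁, Mc, hγ₀, hγh, hε, hE₀, hκ, hκ₀, hc₁, hα₀, hα₁, hMc, hMgMc, hV, ιC, h8, hsw, h9⟩ := H F a ha
  obtain ⟨C₉, δ₀, -, -, hE⟩ := twoVolExpBox_LocUniv_images_geom hE₀ hκ hκ₀ hc₁ F a₀ ε₂₉ γ₀ α₀ α₁ hε hα₀ hα₁ Mc hMc hMgMc ιC h8 hsw h9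
  exact ⟨a₀, ha₀, hle, γ₀, ε₂₉, _, _, M, hγ₀, hγh, hε, hE, hV⟩

end Summit.QuantumFields.YangMills.Theorems.K0AxMomentRoad

end
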